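import Mathlib
import Summits.Ventures.LatticeQCDFlow.TrivializingMaps.StrongCouplingTrivializingMap
import HarnessLib

/-!
# The strong-coupling trivializing map, docked onto Wave 0's Wilson measure `wilsonMeasure ρ β`

HONEST FRAMING: exact (Metropolis-corrected) sampling algorithms for lattice gauge theory; figures
of merit are autocorrelation/cost numbers at stated couplings and volumes; no continuum-physics claim.
Finite periodic lattices `(ℤ/L)^d` only; the coupling window does not depend on `L`.

The venture states Lüscher's objects on AMBIENT configurations (`ambWilsonAction` on `M_n(ℂ)^E`, so that
link derivatives make sense), while the Literature's lattice Yang–Mills measure is Wave 0's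
`wilsonMeasure ρ β = Z⁻¹ e^{-β S_W} ∏ dHaar` for a representation `ρ` (`ConstructiveQFTWave0.lean`,
[Wilson1974], Seiler LNP 159 §1).  This file docks the two (THEORY-1-LEANMAP §F listed the docking as not
in Lean):

* `ambWilsonAction_coeConfig` — on `SU(n)^E`, Lüscher's `S_W(ιU) = ∑_x ∑_{μ<ν} Re tr(1 - U_p)` IS Wave 0's
  `wilsonAction ρ₀ U` for the defining representation `ρ₀ : SU(n) ↪ M_n(ℂ)`;
* `boltzmannMeasure_smul_ambWilsonAction` — hence Lüscher's Boltzmann measure of `β·S_W` (file A,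
  eq. (2.1)) IS `wilsonMeasure ρ₀ β`;
* `exists_isTrivializingMap_wilsonMeasure` — **the strong-coupling theorem of
  `StrongCouplingTrivializingMap.lean` for the Literature object: for every `d`, `n ≠ 0` and orthonormal
  basis `B` of `𝔰𝔲(n)` there is `β₀ > 0` such that for every lattice size `L` and `|β| < β₀` a continuous,
  gauge-equivariant map `𝓕 : SU(n)^E → SU(n)^E` pushes the product Haar measure forward to the Wilson
  lattice Yang–Mills measure, `𝓕_* ∏ dHaar = wilsonMeasure ρ₀ β`.**

M. Lüscher, CMP 293 (2010) 899–919 [Luscher2010Trivializing], §2.1 eq. (2.1), §2.3 eq. (2.9); K. Wilson,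
Phys. Rev. D 10 (1974) 2445 [Wilson1974].  Authored by the pub-lqcd lean-2 seat (cell lqcd-flow, FANOUT
row 31 GEN-4). Tags: [ours] = venture work.
-/

noncomputable section

namespace Summit.Ventures.LatticeQCDFlow.TrivializingMaps

open MeasureTheory
open scoped Matrix Matrix.Norms.Frobenius ENNReal
open Literature.MathematicalPhysics.QuantumFieldTheory
open Literature.MathematicalPhysics.QuantumFieldTheory.Luscher2010
open Summit.Ventures.LatticeQCDFlow.Exactness (IsGaugeEquivariant)

namespace StrongCoupling

variable {d L n : ℕ} [NeZero L]

/-! ## §1. Lüscher's ambient Wilson action is Wave 0's Wilson action on the field manifold -/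

/-- The defining representation `ρ₀ : SU(n) ↪ M_n(ℂ)` (the inclusion of the submonoid). [folklore] -/
abbrev defRep (n : ℕ) : Matrix.specialUnitaryGroup (Fin n) ℂ →* Matrix (Fin n) (Fin n) ℂ :=
  (Matrix.specialUnitaryGroup (Fin n) ℂ).subtype

omit [NeZero L] in
/-- The plaquette term: `Re tr(1 - U(x,μ)U(x+μ̂,ν)U(x+ν̂,μ)ᴴU(x,ν)ᴴ) = n - Re tr ρ₀(U_p)` on `SU(n)^E`
(inverses are conjugate transposes). [folklore] -/
theorem plaquette_term_coeConfig (U : GaugeConfig d L (Matrix.specialUnitaryGroup (Fin n) ℂ))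
    (x : Site d L) (μ ν : Fin d) :
    ((1 : Matrix (Fin n) (Fin n) ℂ) -
        WilsonFlow.coeConfig U (x, μ) * WilsonFlow.coeConfig U (x.shift μ, ν) *
          (WilsonFlow.coeConfig U (x.shift ν, μ))ᴴ * (WilsonFlow.coeConfig U (x, ν))ᴴ).trace.re =
      (n : ℝ) - ((defRep n) (plaquetteHolonomy U x μ ν)).trace.re := by
  rw [Matrix.trace_sub, Complex.sub_re, Matrix.trace_one, Fintype.card_fin]
  simp only [Complex.natCast_re, plaquetteHolonomy, defRep, Submonoid.subtype_apply, Submonoid.coe_mul,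
    WilsonFlow.coeConfig_apply, WilsonFlow.coe_inv_SU]

/-- **Lüscher's ambient Wilson action restricted to `SU(n)^E` is Wave 0's Wilson action** in the defining
representation: `ambWilsonAction (ιU) = wilsonAction ρ₀ U`. [cite: Luscher2010Trivializing, §4.4 eq. (4.16);
Wilson1974] -/
theorem ambWilsonAction_coeConfig (U : GaugeConfig d L (Matrix.specialUnitaryGroup (Fin n) ℂ)) :
    ambWilsonAction (WilsonFlow.coeConfig U) = wilsonAction (defRep n) U := by
  unfold ambWilsonAction wilsonAction
  rw [Fintype.sum_prod_type]
  refine Finset.sum_congr rfl fun x _ => ?_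
  -- the pair sum over `μ < ν` as a sum over the subtype
  rw [← Finset.sum_subtype (Finset.univ.filter fun p : Fin d × Fin d => p.1 < p.2)
    (p := fun p : Fin d × Fin d => p.1 < p.2) (fun p => by simp)
    (f := fun p : Fin d × Fin d => ((n : ℝ) - ((defRep n) (plaquetteHolonomy U x p.1 p.2)).trace.re)),
    Finset.sum_filter, Fintype.sum_prod_type]
  refine Finset.sum_congr rfl fun μ _ => Finset.sum_congr rfl fun ν _ => ?_
  split_ifs with h
  · exact plaquette_term_coeConfig U x μ ν
  · rfl

/-- The scaled actions agree: `β · ambWilsonAction (ιU) = β · wilsonAction ρ₀ U`. [ours] -/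
theorem smul_ambWilsonAction_coeConfig (β : ℝ) (U : GaugeConfig d L (Matrix.specialUnitaryGroup (Fin n) ℂ)) :
    β * ambWilsonAction (WilsonFlow.coeConfig U) = β * wilsonAction (defRep n) U := by
  rw [ambWilsonAction_coeConfig]

/-! ## §2. Lüscher's Boltzmann measure of `β·S_W` is the Wilson measure -/

/-- **`𝒵⁻¹ e^{-β S_W} D[U]` (Lüscher (2.1)) IS Wave 0's `wilsonMeasure ρ₀ β`** (same product Haar reference
measure, same density, same normalisation). [cite: Luscher2010Trivializing, §2.1 eq. (2.1); Wilson1974] -/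
theorem boltzmannMeasure_smul_ambWilsonAction (β : ℝ) :
    boltzmannMeasure (fun U : GaugeConfig d L (Matrix.specialUnitaryGroup (Fin n) ℂ) =>
        β * ambWilsonAction (WilsonFlow.coeConfig U)) =
      wilsonMeasure (d := d) (L := L) (defRep n) β := by
  have hdens : (fun U : GaugeConfig d L (Matrix.specialUnitaryGroup (Fin n) ℂ) =>
      ENNReal.ofReal (Real.exp (-(β * ambWilsonAction (WilsonFlow.coeConfig U))))) =
      fun U => ENNReal.ofReal (Real.exp (-β * wilsonAction (defRep n) U)) := by
    funext U
    rw [smul_ambWilsonAction_coeConfig, neg_mul]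
  unfold boltzmannMeasure partitionFn wilsonMeasure partitionFunction wilsonWeight trivialMeasure
  rw [hdens, withDensity_apply _ MeasurableSet.univ, Measure.restrict_univ]

/-! ## §3. The trivializing map for the Wilson lattice Yang–Mills measure -/

/-- **A gauge-equivariant trivializing map for the Wilson lattice Yang–Mills measure at strong coupling,
every volume (ours; PROVED).**  For every `d`, `n ≠ 0` and orthonormal basis `B` of `𝔰𝔲(n)` there is
`β₀ > 0` (namely `(n^8 θ₁(d,n,B) 3^5 + 1)⁻¹`) such that for EVERY lattice size `L ≥ 1` and every coupling
`|β| < β₀` there is a continuous, gauge-equivariant map `𝓕 : SU(n)^E → SU(n)^E` with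
`𝓕_* (∏_e dHaar) = wilsonMeasure ρ₀ β` — the product of Haar measures is transported EXACTLY onto Wilson's
lattice Yang–Mills measure `Z⁻¹ e^{-β S_W(U)} ∏_e dHaar(U_e)` in the defining representation.  (`𝓕` is the
time-one map of the gradient flow of Lüscher's summed flow-action series, `StrongCouplingTrivializingMap`.)
[ours; cite: Luscher2010Trivializing, §2.3 eq. (2.9), §4.2; Wilson1974] -/
theorem exists_isTrivializingMap_wilsonMeasure (hn : n ≠ 0) (B : SuBasis n) :
    ∃ β₀ : ℝ, 0 < β₀ ∧ ∀ (L : ℕ) [NeZero L] (β : ℝ), |β| < β₀ →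
      ∃ F : GaugeConfig d L (Matrix.specialUnitaryGroup (Fin n) ℂ) →
          GaugeConfig d L (Matrix.specialUnitaryGroup (Fin n) ℂ),
        Continuous F ∧ IsGaugeEquivariant F ∧ Measurable F ∧
        Measure.map F (Measure.pi fun _ : Edge d L => haarProbability (Matrix.specialUnitaryGroup (Fin n) ℂ)) =
          wilsonMeasure (d := d) (L := L) (defRep n) β := by
  obtain ⟨β₀, hβ₀, h⟩ := exists_isTrivializingMap_smul_ambWilsonAction (d := d) hn B
  refine ⟨β₀, hβ₀, fun L _ β hβ => ?_⟩
  obtain ⟨F, hF, hG, htriv⟩ := h L β hβ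
  refine ⟨F, hF, hG, htriv.1, ?_⟩
  rw [← boltzmannMeasure_smul_ambWilsonAction β]
  exact htriv.2

/-- **Expectations of the Wilson measure through the trivializing map**: for `|β| < β₀` and every
observable `𝒪` (a.e.-strongly measurable for `wilsonMeasure ρ₀ β`),
`∫ 𝒪 dμ_{Λ,β} = ∫ 𝒪(𝓕(V)) ∏ dHaar(V)` (Lüscher (2.9) for Wilson's measure). [ours; cite:
Luscher2010Trivializing, §2.3 eq. (2.9)] -/
theorem exists_integral_wilsonMeasure_comp (hn : n ≠ 0) (B : SuBasis n) :
    ∃ β₀ : ℝ, 0 < β₀ ∧ ∀ (L : ℕ) [NeZero L] (β : ℝ), |β| < β₀ →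
      ∃ F : GaugeConfig d L (Matrix.specialUnitaryGroup (Fin n) ℂ) →
          GaugeConfig d L (Matrix.specialUnitaryGroup (Fin n) ℂ),
        Continuous F ∧ IsGaugeEquivariant F ∧
        ∀ O : GaugeConfig d L (Matrix.specialUnitaryGroup (Fin n) ℂ) → ℝ,
          AEStronglyMeasurable O (wilsonMeasure (d := d) (L := L) (defRep n) β) →
          ∫ U, O U ∂(wilsonMeasure (d := d) (L := L) (defRep n) β) =
            ∫ V, O (F V) ∂(Measure.pi fun _ : Edge d L => haarProbability (Matrix.specialUnitaryGroup (Fin n) ℂ)) := by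
  obtain ⟨β₀, hβ₀, h⟩ := exists_isTrivializingMap_smul_ambWilsonAction (d := d) hn B
  refine ⟨β₀, hβ₀, fun L _ β hβ => ?_⟩
  obtain ⟨F, hF, hG, htriv⟩ := h L β hβ
  refine ⟨F, hF, hG, fun O hO => ?_⟩
  have hO' : AEStronglyMeasurable O (boltzmannMeasure fun U : GaugeConfig d L (Matrix.specialUnitaryGroup (Fin n) ℂ) =>
      β * ambWilsonAction (WilsonFlow.coeConfig U)) := by
    rwa [boltzmannMeasure_smul_ambWilsonAction β]
  have h1 := htriv.integral_comp hO'
  rw [boltzmannMeasure_smul_ambWilsonAction β] at h1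
  exact h1

end StrongCoupling

end Summit.Ventures.LatticeQCDFlow.TrivializingMaps

end
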